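import Summits.PneNP.PneNP.Theorems.PhaseTwinsPolyDepthTwinsAboveDefs
import Literature.ModelTheory.FiniteModelTheory.CkEquivTransfer

/-!
# Route PhaseTwins, crux `MacroscopicTwinsAbove` (stmt-PneNP-2720): the literal-gadget graphs (definitions)

Objects posited by the line `literal-gadgets-cfi-apparatus` for the crux `PhaseTwins.MacroscopicTwinsAbove`
(skeleton `Summits/PneNP/PneNP/Cruxes/MacroscopicTwinsAbove/Lines/literal-gadgets-cfi-apparatus.lean`, whose registered
stubs are stated in exactly this vocabulary and namespace). ONE Sly phase gadget `(G, W±, V±)`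
(`Literature.Computability.Complexity.slyGadgetReduction`) is copied once per LITERAL `(x, a)`, `x < nv`, `a : ZMod 2`,
of a 3-XOR system `E : Fin m → Fin 3 → Fin nv` (equation `e` reads `x_{E e 0} + x_{E e 1} + x_{E e 2} = b e`); the two
literal gadgets of a variable are anti-aligned by `κ₁` two-sided PAIR bundles (`V⁺–V⁺` and `V⁻–V⁻`, same slot on both
sides); every equation carries `K` ten-vertex Cai–Fürer–Immerman parity complexes of charge `b e`, whose end `(e, j, i, a)`
plugs into the `V⁺` port in end slot `(loc (e, i), j)` of the literal gadget of `(E e i, a)`: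

* `LGVert nv m v K` — the uniform vertex type: COPY vertices `(x, a, y)`, END vertices `(e, j, i, a)`, INNER vertices
  `(e, j, S')` (inner vertices carry two free bits, the third is fixed by the charge through `CFIMatching.bit`, so both
  twins live on ONE type);
* `LWiring v P κ₁ D K` — the gadget with its port embeddings and an injective SLOT map (`κ₁` pair slots, `D·K` end
  slots); `slotEmb`; `lgScope` (the scope of an equation as a `Finset`, the shape consumed by `XorSystem.boundary/Good`);
* `lgRel`/`lgGraph E loc W b` — the literal-gadget graph; `lgBaseRel`/`lgBase` — the disjoint union of the `2nv` literal
  gadgets with the `10mK` complex vertices isolated (Sly's `Ĥ^G` for this wiring);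
* `lgFib`, `lgPhase` — the configuration on a literal gadget and the PHASE VECTOR (`slyPhase` per copy); `lgRef` — the
  planted phase vector (`g_{x,0}` in phase `+`, `g_{x,1}` in phase `−`);
* `lgW` — the explicit product-measure weight of a phase vector (pair factors `pairW` and complex factors `cxW` of the
  sibling definitions file `PhaseTwinsPolyDepthTwinsAboveDefs`); `LGCutEstimate` — the two conclusions of the copy-explicit
  Sly Lemma 2.2 for this wiring (`(phaseProbs)` and the two-sided `(cutProb)` with error `(1 ± δ)^{2nv}`);
* `lgFlipFun`/`lgFlip` — the gauge action of an assignment `f : Fin nv → ZMod 2` (literal gadgets permuted as blocks,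
  complex vertices relabelled inside their complex, never a port renamed), `lgData` — the `≤ 3` variables a vertex
  depends on; `isLocalFlipAction_lgFlip` — these form a local flip action (input of `ckEquiv_of_consistencyFamily`).

Definitions and their unfolding/structural lemmas only; the stubs and the composition live in the skeleton and land as
`PhaseTwinsMacroscopicTwinsAbove*.lean`. Sources of the construction: Sly 2010 §2.1–2.2 (gadget, phases, `Q_V^{±}`, `H^G`);
Cai–Fürer–Immerman 1992 §6 / Dawar–Wilsenach 2025 §7.2 (the inner/end complex); Atserias–Dawar 2019 Lemma 3.2 (gauge
covariance of the wiring). [folklore]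
-/

noncomputable section

open scoped Classical BigOperators

namespace Summit.PneNP.PneNP.Cruxes.MacroscopicTwinsAbove.LiteralGadgetsCfiApparatus

open Finset
open Literature.Computability.Complexity (hardcoreZOn slyPhase)
open Literature.ModelTheory.FiniteModelTheory (IsLocalFlipAction)
open Literature.ModelTheory.FiniteModelTheory.CFIMatching (bit)
open Literature.Probability.LatticeModels (independencePolynomial)
open Summit.PneNP.PneNP.Cruxes.PolyDepthTwinsAbove.ParityWiredPorts (pairW cxW)

-- `Summit.PneNP.PneNP.…` (summit = sub-problem name) trips the duplicate-namespace linter on every declaration.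
set_option linter.dupNamespace false

variable {nv m v P κ₁ D K : ℕ}

/-! ## The construction -/

/-- Vertices of the literal-gadget graph: COPY vertices `(x, a, y)` (vertex `y : Fin v` of the literal gadget
`g_{x,a}`, one copy per variable `x` and value `a`), END vertices `(e, j, i, a)` and INNER vertices
`(e, j, S')` of the `j`-th (`j < K`) ten-vertex CFI complex of equation `e`. Uniform in the system and in the
right-hand side (one vertex type for both twins). -/
abbrev LGVert (nv m v K : ℕ) : Type :=
  (Fin nv × ZMod 2 × Fin v) ⊕ (Fin m × Fin K × Fin 3 × ZMod 2) ⊕ (Fin m × Fin K × (Fin 2 → ZMod 2))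

/-- A gadget with its wiring data: Sly's `(G, W⁺, W⁻, V⁺, V⁻)` on `Fin v` with `P` ports of each sign, and an
injective SLOT assignment: `κ₁` pair slots and `D·K` end slots (occurrence colour `ℓ < D`, copy index `j < K`). -/
structure LWiring (v P κ₁ D K : ℕ) where
  /-- the gadget -/
  G : SimpleGraph (Fin v)
  /-- the `+`-side of the phase-defining vertex set -/
  Wp : Finset (Fin v)
  /-- the `−`-side of the phase-defining vertex set -/
  Wm : Finset (Fin v)
  /-- the `V⁺` ports -/
  Vp : Fin P ↪ Fin v
  /-- the `V⁻` ports -/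
  Vm : Fin P ↪ Fin v
  /-- the slot assignment: `κ₁` pair slots and `D·K` end slots, pairwise distinct ports -/
  slot : Fin κ₁ ⊕ (Fin D × Fin K) ↪ Fin P

/-- The slot assignment from a cardinality bound (slots `0 … κ₁ + DK − 1`). -/
def slotEmb {κ₁ D K P : ℕ} (h : Fintype.card (Fin κ₁ ⊕ (Fin D × Fin K)) ≤ P) :
    Fin κ₁ ⊕ (Fin D × Fin K) ↪ Fin P :=
  (Fintype.equivFin (Fin κ₁ ⊕ (Fin D × Fin K))).toEmbedding.trans (Fin.castLEEmb h)

/-- The scope of equation `e` as a set of variables (shape of `XorSystem.boundary` / `XorSystem.Good`). -/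
def lgScope (E : Fin m → Fin 3 → Fin nv) (e : Fin m) : Finset (Fin nv) := Finset.univ.image (E e)

/-- Generating adjacency of `lgGraph E loc W b`: (copy–copy) the gadget inside each literal gadget, and the
`κ₁ + κ₁` PAIR edges `V⁺(slot j)—V⁺(slot j)`, `V⁻(slot j)—V⁻(slot j)` between `g_{x,0}` and `g_{x,1}`;
(end–copy) the end `(e, j, i, a)` is adjacent to the `V⁺` port in end slot `(loc (e,i), j)` of `g_{E e i, a}`;
(inner–end) `(e, j, S') — (e, j, i, bit (b e) S' i)` (the CFI complex of charge `b e`). -/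
def lgRel (E : Fin m → Fin 3 → Fin nv) (loc : Fin m × Fin 3 → Fin D) (W : LWiring v P κ₁ D K)
    (b : Fin m → ZMod 2) : LGVert nv m v K → LGVert nv m v K → Prop
  | .inl (x, a, y), .inl (x', a', y') =>
      (x' = x ∧ a' = a ∧ W.G.Adj y y') ∨
      (x' = x ∧ a' = a + 1 ∧ ∃ j : Fin κ₁,
        (y = W.Vp (W.slot (Sum.inl j)) ∧ y' = W.Vp (W.slot (Sum.inl j))) ∨
        (y = W.Vm (W.slot (Sum.inl j)) ∧ y' = W.Vm (W.slot (Sum.inl j))))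
  | .inr (.inl (e, j, i, a)), .inl (x', a', y') =>
      x' = E e i ∧ a' = a ∧ y' = W.Vp (W.slot (Sum.inr (loc (e, i), j)))
  | .inr (.inr (e, j, S')), .inr (.inl (e', j', i, a)) => e' = e ∧ j' = j ∧ bit (b e) S' i = a
  | _, _ => False

/-- **The literal-gadget graph** `𝔊(E, b)` over the system `E`, the occurrence colouring `loc`, the gadget/wiring
`W` and the right-hand side `b`. -/
def lgGraph (E : Fin m → Fin 3 → Fin nv) (loc : Fin m × Fin 3 → Fin D) (W : LWiring v P κ₁ D K)
    (b : Fin m → ZMod 2) : SimpleGraph (LGVert nv m v K) :=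
  SimpleGraph.fromRel (lgRel E loc W b)

/-- Generating adjacency of the connector-free, coupling-free graph: the `2·nv` disjoint literal gadgets
(end and inner vertices isolated). -/
def lgBaseRel (nv m : ℕ) (W : LWiring v P κ₁ D K) : LGVert nv m v K → LGVert nv m v K → Prop
  | .inl (x, a, y), .inl (x', a', y') => x' = x ∧ a' = a ∧ W.G.Adj y y'
  | _, _ => False

/-- The disjoint union of the literal gadgets (Sly's `Ĥ^G` for this wiring). -/
def lgBase (nv m : ℕ) (W : LWiring v P κ₁ D K) : SimpleGraph (LGVert nv m v K) :=
  SimpleGraph.fromRel (lgBaseRel nv m W)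

/-- The configuration on the literal gadget `g`: its fibre. -/
def lgFib (I : Finset (LGVert nv m v K)) (g : Fin nv × ZMod 2) : Finset (Fin v) :=
  univ.filter fun y => (Sum.inl (g.1, g.2, y) : LGVert nv m v K) ∈ I

/-- The PHASE VECTOR of a configuration: Sly's phase of its restriction to every literal gadget. -/
def lgPhase (W : LWiring v P κ₁ D K) (I : Finset (LGVert nv m v K)) : Fin nv × ZMod 2 → Bool :=
  fun g => slyPhase W.Wp W.Wm (lgFib I g)

/-- The reference (planted) phase vector: `g_{x,0}` in phase `+`, `g_{x,1}` in phase `−`, for every `x`. -/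
def lgRef {nv : ℕ} : Fin nv × ZMod 2 → Bool := fun p => decide (p.2 = 0)

/-- **The weight of a phase vector** `Y` under the right-hand side `b` (product-measure value of the wiring
given the phases): the pair factor of every variable times the `K`-th power of the complex factor of every
equation (all `K` complexes of `e` read the phases of the six literal gadgets `g_{E e i, a}`). -/
def lgW (E : Fin m → Fin 3 → Fin nv) (lam qp qm : ℝ) (κ₁ K : ℕ) (b : Fin m → ZMod 2)
    (Y : Fin nv × ZMod 2 → Bool) : ℝ :=
  (∏ x : Fin nv, pairW qp qm κ₁ (Y (x, 0)) (Y (x, 1))) *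
    ∏ e : Fin m, cxW lam qp qm (b e) (fun p => Y (E e p.1, p.2)) ^ K

/-- **The conclusions of the copy-explicit Lemma 2.2 for the literal-gadget wiring**: for every phase vector `Y`,
`(phaseProbs)` `Z_base(Y) ≥ n^{-2nv} Z_base` and the two-sided `(cutProb)`
`(1-δ)^{2nv} · lgW b Y · Z_base(Y) ≤ Z_{𝔊(E,b)}(Y) ≤ (1+δ)^{2nv} · lgW b Y · Z_base(Y)` — errors explicit in the
number `2nv` of gadget copies, NO bound on `nv`. -/
def LGCutEstimate (E : Fin m → Fin 3 → Fin nv) (loc : Fin m × Fin 3 → Fin D) (W : LWiring v P κ₁ D K)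
    (lam qp qm δ : ℝ) (n : ℕ) (b : Fin m → ZMod 2) : Prop :=
  ∀ Y : Fin nv × ZMod 2 → Bool,
    ((n : ℝ) ^ (2 * nv))⁻¹ * independencePolynomial (lgBase nv m W) lam ≤
        hardcoreZOn (lgBase nv m W) lam (fun I => lgPhase W I = Y) ∧
      (1 - δ) ^ (2 * nv) * (lgW E lam qp qm κ₁ K b Y *
          hardcoreZOn (lgBase nv m W) lam (fun I => lgPhase W I = Y)) ≤
        hardcoreZOn (lgGraph E loc W b) lam (fun I => lgPhase W I = Y) ∧
      hardcoreZOn (lgGraph E loc W b) lam (fun I => lgPhase W I = Y) ≤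
        (1 + δ) ^ (2 * nv) * (lgW E lam qp qm κ₁ K b Y *
          hardcoreZOn (lgBase nv m W) lam (fun I => lgPhase W I = Y))

/-! ## The gauge action -/

/-- The gauge action of an assignment `f` on the vertices (a port is never renamed): literal gadgets are
permuted as blocks, complex vertices relabelled inside their complex. -/
def lgFlipFun (E : Fin m → Fin 3 → Fin nv) (f : Fin nv → ZMod 2) : LGVert nv m v K → LGVert nv m v K
  | .inl (x, a, y) => .inl (x, a + f x, y)
  | .inr (.inl (e, j, i, a)) => .inr (.inl (e, j, i, a + f (E e i)))
  | .inr (.inr (e, j, S')) => .inr (.inr (e, j, S' + fun i => f (E e (Fin.castSucc i))))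

/-- The data of a vertex (the variables whose flips move it or its edges): `≤ 3` variables. -/
def lgData (E : Fin m → Fin 3 → Fin nv) : LGVert nv m v K → Finset (Fin nv)
  | .inl (x, _, _) => {x}
  | .inr (.inl (e, _, i, _)) => {E e i}
  | .inr (.inr (e, _, _)) => lgScope E e

/-- The data of a vertex has at most three variables (`c₀ = 3` in `ckEquiv_of_consistencyFamily`). -/
theorem card_lgData_le (E : Fin m → Fin 3 → Fin nv) (x : LGVert nv m v K) : (lgData E x).card ≤ 3 := by
  rcases x with ⟨x, a, y⟩ | ⟨e, j, i, a⟩ | ⟨e, j, S'⟩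
  · simp [lgData]
  · simp [lgData]
  · simp only [lgData, lgScope]
    exact Finset.card_image_le.trans (by simp)

/-- Flips preserve the data (the `data_apply` field of `IsLocalFlipAction`). -/
theorem lgData_lgFlipFun (E : Fin m → Fin 3 → Fin nv) (f : Fin nv → ZMod 2) (x : LGVert nv m v K) :
    lgData E (lgFlipFun (v := v) (K := K) E f x) = lgData E x := by
  rcases x with ⟨x, a, y⟩ | ⟨e, j, i, a⟩ | ⟨e, j, S'⟩ <;> rfl

/-- Flipping twice by the same assignment is the identity (`ZMod 2`). -/
theorem lgFlipFun_lgFlipFun (E : Fin m → Fin 3 → Fin nv) (f : Fin nv → ZMod 2) (x : LGVert nv m v K) :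
    lgFlipFun E f (lgFlipFun E f x) = x := by
  have h2 : ∀ a : ZMod 2, a + a = 0 := by decide
  have h3 : ∀ g : Fin 2 → ZMod 2, g + g = 0 := fun g => funext fun i => h2 (g i)
  rcases x with ⟨x, a, y⟩ | ⟨e, j, i, a⟩ | ⟨e, j, S'⟩
  · simp [lgFlipFun, add_assoc, h2]
  · simp [lgFlipFun, add_assoc, h2]
  · simp [lgFlipFun, add_assoc, h3]

/-- **The flip** by `f` as a permutation of the vertices (an involution). -/
def lgFlip (E : Fin m → Fin 3 → Fin nv) (f : Fin nv → ZMod 2) : LGVert nv m v K ≃ LGVert nv m v K :=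
  Function.Involutive.toPerm (lgFlipFun E f) (lgFlipFun_lgFlipFun E f)

/-- Unfolding `lgFlip`. -/
theorem lgFlip_apply (E : Fin m → Fin 3 → Fin nv) (f : Fin nv → ZMod 2) (x : LGVert nv m v K) :
    lgFlip E f x = lgFlipFun E f x := rfl

/-- The flips form a LOCAL FLIP ACTION for the data map `lgData` (one of the three inputs of the transfer theorem
`ckEquiv_of_consistencyFamily`): the image of a vertex depends only on `f` restricted to its data, and the data is
preserved. -/
theorem isLocalFlipAction_lgFlip (E : Fin m → Fin 3 → Fin nv) :
    IsLocalFlipAction (lgData (v := v) (K := K) E) (lgFlip E) := by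
  refine ⟨fun f g x hfg => ?_, fun f x => lgData_lgFlipFun E f x⟩
  show lgFlipFun E f x = lgFlipFun E g x
  rcases x with ⟨x, a, y⟩ | ⟨e, j, i, a⟩ | ⟨e, j, S'⟩
  · have h := hfg x (by simp [lgData])
    simp [lgFlipFun, h]
  · have h := hfg (E e i) (by simp [lgData])
    simp [lgFlipFun, h]
  · have h : ∀ i : Fin 2, f (E e (Fin.castSucc i)) = g (E e (Fin.castSucc i)) :=
      fun i => hfg _ (by simp [lgData, lgScope])
    simp [lgFlipFun, h]

/-! ## Unfolding -/

/-- Adjacency of the literal-gadget graph: the symmetrised, irreflexive closure of the generating relation `lgRel`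
(registered anchor lemma of this definitions file). -/
theorem lgGraph_adj (E : Fin m → Fin 3 → Fin nv) (loc : Fin m × Fin 3 → Fin D) (W : LWiring v P κ₁ D K)
    (b : Fin m → ZMod 2) (x y : LGVert nv m v K) :
    (lgGraph E loc W b).Adj x y ↔ x ≠ y ∧ (lgRel E loc W b x y ∨ lgRel E loc W b y x) :=
  SimpleGraph.fromRel_adj _ _ _

/-- Adjacency of the disjoint union of the literal gadgets. -/
theorem lgBase_adj (nv m : ℕ) (W : LWiring v P κ₁ D K) (x y : LGVert nv m v K) :
    (lgBase nv m W).Adj x y ↔ x ≠ y ∧ (lgBaseRel nv m W x y ∨ lgBaseRel nv m W y x) :=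
  SimpleGraph.fromRel_adj _ _ _

/-- The base graph is a subgraph of every literal-gadget graph (adding the wiring only adds edges). -/
theorem lgBase_le_lgGraph (E : Fin m → Fin 3 → Fin nv) (loc : Fin m × Fin 3 → Fin D) (W : LWiring v P κ₁ D K)
    (b : Fin m → ZMod 2) : lgBase nv m W ≤ lgGraph E loc W b := by
  intro x y h
  rw [lgBase_adj] at h
  rw [lgGraph_adj]
  refine ⟨h.1, ?_⟩
  rcases h.2 with h2 | h2
  · rcases x with ⟨x, a, z⟩ | ⟨e, j, i, a⟩ | ⟨e, j, S'⟩ <;> rcases y with ⟨x', a', z'⟩ | ⟨e', j', i', a'⟩ | ⟨e', j', S''⟩ <;>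
      simp only [lgBaseRel] at h2
    exact Or.inl (Or.inl h2)
  · rcases x with ⟨x, a, z⟩ | ⟨e, j, i, a⟩ | ⟨e, j, S'⟩ <;> rcases y with ⟨x', a', z'⟩ | ⟨e', j', i', a'⟩ | ⟨e', j', S''⟩ <;>
      simp only [lgBaseRel] at h2
    exact Or.inr (Or.inl h2)

/-- Membership in the fibre over a literal gadget. -/
theorem mem_lgFib (I : Finset (LGVert nv m v K)) (g : Fin nv × ZMod 2) (y : Fin v) :
    y ∈ lgFib I g ↔ (Sum.inl (g.1, g.2, y) : LGVert nv m v K) ∈ I := by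
  simp [lgFib]

/-- The number of vertices of the literal-gadget graph: `N = 2·nv·v + 10·m·K`. -/
theorem card_LGVert (nv m v K : ℕ) : Fintype.card (LGVert nv m v K) = 2 * nv * v + 10 * m * K := by
  simp only [LGVert, Fintype.card_sum, Fintype.card_prod, Fintype.card_fin, ZMod.card, Fintype.card_fun]
  ring

end Summit.PneNP.PneNP.Cruxes.MacroscopicTwinsAbove.LiteralGadgetsCfiApparatus
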